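import Mathlib
import Summits.CriticalPhenomena.Ising3DConformalLimit.Theses.GaussianScaleMixture
import Literature.MathematicalPhysics.QuantumFieldTheory.LatticeMirrorNormals
import Literature.MathematicalPhysics.QuantumFieldTheory.MirrorRPKernel

/-!
# `GSMRigidity` (item stmt-CriticalPhenomena-8366): reflection positivity is load-bearing — the three-atom kernel

Negative knowledge about the crux
`Summit.CriticalPhenomena.Ising3DConformalLimit.Theses.GaussianScaleMixture.GSMRigidity`
(standing crux disprover, cycle 1, D-0016), split off its work file
`Summits/CriticalPhenomena/Ising3DConformalLimit/Cruxes/GSMRigidity/Disproof.lean`.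

* `threeAtomKernel x = Σᵢ 1/(Σⱼ xⱼ² + xᵢ²)`: the exchangeable three-atom Gaussian scale mixture at
  `Δ = 1`. It is continuous off the origin, positive, homogeneous of degree `-2`, invariant under the
  nine lattice mirrors, an honest Gaussian scale mixture in the sense of the crux
  (`threeAtomKernel_isGSM`: the measure `ν = Σᵢ (r ↦ r(𝟙 + eᵢ))_* Leb|_(0,∞)` on `Fin 3 → ℝ`, with the
  integrability and the integral identity proved), and ANISOTROPIC
  (`K e₀ = 5/2 ≠ 297/130 = K (θ_{(1,1,1)} e₀)`).
* `not_gsmRigidity_without_RP`: hence the crux with its reflection-positivity conjunct deleted (all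
  nine mirror invariances, the window `1/2 ≤ Δ ≤ 1`, continuity, positivity, homogeneity and the GSM
  representation kept) is FALSE — any proof of `GSMRigidity` must use reflection positivity;
  `gsmRigidity_of_withoutRP` records that the deleted variant implies the crux.
* `threeAtomKernel_not_swapRP`: WHICH reflection positivity kills the witness — the diagonal (swap)
  mirror `x₁ = x₂`, by an exact four-point certificate: points `(3,-3,0), (4,-2,0), (5,-1,0), (6,0,0)`,
  coefficients `(5,-14,14,-5)`, value of the RP form `-3305/17120862 < 0`. (The three coordinate
  mirrors are RP for this kernel on paper — each atom is a Riesz kernel `‖A x‖^{-2}` after a diagonal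
  change of variables, Frank–Lieb 2010, Lemma 2.1 — so, as for `HRP2Rigidity`, the six diagonal
  mirrors carry the content.)

No new `Prop` definitions; the only definitions are the explicit witness data.
-/

noncomputable section

open scoped BigOperators InnerProductSpace
open MeasureTheory Set Literature.MathematicalPhysics.QuantumFieldTheory

namespace Summit.CriticalPhenomena.Ising3DConformalLimit.Theorems.GSMRigidity.Negative

/-- Shorthand for `ℝ³`. [folklore] -/
abbrev E3 := EuclideanSpace ℝ (Fin 3)

/-! ## The witness kernel -/

/-- The exchangeable three-atom Gaussian scale mixture at `Δ = 1`:
`K x = Σᵢ 1/(Σⱼ xⱼ² + xᵢ²) = Σᵢ ∫₀^∞ exp(-r(‖x‖² + xᵢ²)) dr`. [folklore] -/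
def threeAtomKernel (x : E3) : ℝ := ∑ i, 1 / ((∑ j, x j ^ 2) + x i ^ 2)

/-- A nonzero vector has a nonzero coordinate. [folklore] -/
theorem exists_coord_ne_zero {x : E3} (hx : x ≠ 0) : ∃ i, x i ≠ 0 := by
  by_contra h
  push Not at h
  exact hx (PiLp.ext fun i => by simpa using h i)

/-- `Σ xᵢ² > 0` off the origin. [folklore] -/
theorem sum_sq_pos {x : E3} (hx : x ≠ 0) : 0 < ∑ i, x i ^ 2 := by
  obtain ⟨i, hi⟩ := exists_coord_ne_zero hx
  exact Finset.sum_pos' (fun j _ => by positivity) ⟨i, Finset.mem_univ _, by positivity⟩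

/-- The denominators of the witness are positive off the origin. [folklore] -/
theorem denom_pos {x : E3} (hx : x ≠ 0) (i : Fin 3) : 0 < (∑ j, x j ^ 2) + x i ^ 2 :=
  add_pos_of_pos_of_nonneg (sum_sq_pos hx) (sq_nonneg _)

/-- The witness is positive off the origin. [folklore] -/
theorem threeAtomKernel_pos {x : E3} (hx : x ≠ 0) : 0 < threeAtomKernel x :=
  Finset.sum_pos (fun i _ => one_div_pos.2 (denom_pos hx i)) Finset.univ_nonempty

/-- Coordinates are continuous. [folklore] -/
theorem continuous_coord (i : Fin 3) : Continuous fun x : E3 => x i :=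
  (EuclideanSpace.proj i).continuous

/-- The witness is continuous off the origin. [folklore] -/
theorem threeAtomKernel_continuousOn : ContinuousOn threeAtomKernel {0}ᶜ := by
  have hs : Continuous fun x : E3 => ∑ j, x j ^ 2 :=
    continuous_finsetSum _ fun j _ => (continuous_coord j).pow 2
  refine continuousOn_finsetSum _ fun i _ => ?_
  refine ContinuousOn.div continuousOn_const (hs.add ((continuous_coord i).pow 2)).continuousOn ?_
  intro x hx
  exact (denom_pos hx i).ne'

/-- The witness is homogeneous of degree `-2 = -2Δ`, `Δ = 1`. [folklore] -/
theorem threeAtomKernel_smul {c : ℝ} (hc : 0 < c) (x : E3) :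
    threeAtomKernel (c • x) = c ^ (-(2 * (1:ℝ))) * threeAtomKernel x := by
  unfold threeAtomKernel
  rw [show (-(2 * (1:ℝ))) = ((-2 : ℤ) : ℝ) by norm_num, Real.rpow_intCast, Finset.mul_sum]
  refine Finset.sum_congr rfl fun i _ => ?_
  simp only [PiLp.smul_apply, smul_eq_mul, mul_pow]
  rw [← Finset.mul_sum]
  have hc2 : c ^ 2 ≠ 0 := pow_ne_zero _ hc.ne'
  by_cases hD : (∑ j, x j ^ 2) + x i ^ 2 = 0
  · have : c ^ 2 * ∑ j, x j ^ 2 + c ^ 2 * x i ^ 2 = 0 := by rw [← mul_add, hD, mul_zero]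
    rw [this, hD]; simp
  · field_simp

/-- Coordinate-even, permutation-symmetric sums are invariant under the nine lattice mirrors
(signed transpositions of the coordinates). [folklore] -/
theorem sum_comp_reflection_eq (F : ℝ → ℝ) (hF : ∀ a, F (-a) = F a) (n : E3)
    (hn : ∃ i j : Fin 3, i ≠ j ∧ (n = EuclideanSpace.single i 1 ∨
      n = EuclideanSpace.single i 1 + EuclideanSpace.single j 1 ∨
      n = EuclideanSpace.single i 1 - EuclideanSpace.single j 1)) (x : E3) :
    ∑ l, F (((ℝ ∙ n)ᗮ.reflection x) l) = ∑ l, F (x l) := by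
  obtain ⟨i, j, hij, rfl | rfl | rfl⟩ := hn
  · refine Finset.sum_congr rfl fun l _ => ?_
    rw [reflection_single_apply]
    split_ifs <;> simp [hF]
  · calc ∑ l, F (((ℝ ∙ (EuclideanSpace.single i (1:ℝ) + EuclideanSpace.single j 1))ᗮ.reflection x) l)
        = ∑ l, F (x (Equiv.swap i j l)) := by
          refine Finset.sum_congr rfl fun l _ => ?_
          rw [reflection_single_add_single_apply hij]
          by_cases hli : l = i
          · subst hli; simp [hF]
          · by_cases hlj : l = j
            · subst hlj; simp [hli, hF]
            · simp [hli, hlj, Equiv.swap_apply_of_ne_of_ne hli hlj]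
      _ = ∑ l, F (x l) := Equiv.sum_comp (Equiv.swap i j) (fun l => F (x l))
  · calc ∑ l, F (((ℝ ∙ (EuclideanSpace.single i (1:ℝ) - EuclideanSpace.single j 1))ᗮ.reflection x) l)
        = ∑ l, F (x (Equiv.swap i j l)) := by
          refine Finset.sum_congr rfl fun l _ => ?_
          rw [reflection_single_sub_single_apply hij]
      _ = ∑ l, F (x l) := Equiv.sum_comp (Equiv.swap i j) (fun l => F (x l))

/-- The witness is invariant under the nine lattice mirrors. [folklore] -/
theorem threeAtomKernel_reflection (n : E3)
    (hn : ∃ i j : Fin 3, i ≠ j ∧ (n = EuclideanSpace.single i 1 ∨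
      n = EuclideanSpace.single i 1 + EuclideanSpace.single j 1 ∨
      n = EuclideanSpace.single i 1 - EuclideanSpace.single j 1)) (x : E3) :
    threeAtomKernel (((ℝ ∙ n)ᗮ).reflection x) = threeAtomKernel x := by
  unfold threeAtomKernel
  rw [sum_comp_reflection_eq (fun a => a ^ 2) (fun a => by ring) n hn x]
  exact sum_comp_reflection_eq (fun a => 1 / ((∑ j, x j ^ 2) + a ^ 2)) (fun a => by ring) n hn x

/-- The body diagonal `(1,1,1)`. [folklore] -/
def v111 : E3 :=
  EuclideanSpace.single 0 1 + EuclideanSpace.single 1 1 + EuclideanSpace.single 2 1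

/-- Coordinates of `(1,1,1)`. [folklore] -/
theorem v111_apply (l : Fin 3) : v111 l = 1 := by
  unfold v111
  fin_cases l <;> simp

/-- `θ_{(1,1,1)} e₀ = e₀ - (2/3)(1,1,1)`. [folklore] -/
theorem reflection_v111_e0_apply (l : Fin 3) :
    ((ℝ ∙ v111)ᗮ.reflection (EuclideanSpace.single (0 : Fin 3) (1 : ℝ))) l =
      (if l = 0 then 1 else 0) - 2 / 3 := by
  have hinner : ⟪EuclideanSpace.single (0 : Fin 3) (1 : ℝ), v111⟫_ℝ = 1 := by
    rw [inner_single_one_left, v111_apply]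
  have hnorm : ‖v111‖ ^ 2 = 3 := by
    rw [EuclideanSpace.norm_eq, Real.sq_sqrt (Finset.sum_nonneg fun _ _ => by positivity)]
    norm_num [v111_apply, Fin.sum_univ_three]
  rw [mirrorReflection_apply, hinner, hnorm]
  norm_num [v111_apply]

/-- `K e₀ = 5/2`. [folklore] -/
theorem threeAtomKernel_e0 : threeAtomKernel (EuclideanSpace.single (0 : Fin 3) (1 : ℝ)) = 5 / 2 := by
  unfold threeAtomKernel
  simp [Fin.sum_univ_three]
  norm_num

/-- `K (θ_{(1,1,1)} e₀) = 297/130`. [folklore] -/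
theorem threeAtomKernel_reflection_v111_e0 :
    threeAtomKernel ((ℝ ∙ v111)ᗮ.reflection (EuclideanSpace.single (0 : Fin 3) (1 : ℝ))) = 297 / 130 := by
  unfold threeAtomKernel
  have h0 : ((ℝ ∙ v111)ᗮ.reflection (EuclideanSpace.single (0 : Fin 3) (1 : ℝ))) 0 = 1 / 3 := by
    rw [reflection_v111_e0_apply, if_pos rfl]; norm_num
  have h1 : ((ℝ ∙ v111)ᗮ.reflection (EuclideanSpace.single (0 : Fin 3) (1 : ℝ))) 1 = -(2 / 3) := by
    rw [reflection_v111_e0_apply, if_neg (by decide)]; norm_num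
  have h2 : ((ℝ ∙ v111)ᗮ.reflection (EuclideanSpace.single (0 : Fin 3) (1 : ℝ))) 2 = -(2 / 3) := by
    rw [reflection_v111_e0_apply, if_neg (by decide)]; norm_num
  simp only [Fin.sum_univ_three, h0, h1, h2]
  norm_num

/-! ## The witness is a Gaussian scale mixture (an honest measure `ν`) -/

/-- The ray `r ↦ r(𝟙 + eᵢ)` in the closed octant. [folklore] -/
def rayVec (i : Fin 3) (r : ℝ) : Fin 3 → ℝ := fun j => r * (if j = i then 2 else 1)

/-- `rayVec i` is measurable. [folklore] -/
theorem measurable_rayVec (i : Fin 3) : Measurable (rayVec i) :=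
  measurable_pi_lambda _ fun _ => measurable_id.mul_const _

/-- The mixing measure `ν = Σᵢ (rayVec i)_* (Lebesgue on (0,∞))` of the witness. [folklore] -/
def gsmMeasure : Measure (Fin 3 → ℝ) :=
  ∑ i : Fin 3, Measure.map (rayVec i) (volume.restrict (Ioi (0:ℝ)))

/-- The complement of the closed octant is measurable. [folklore] -/
theorem measurableSet_negSet : MeasurableSet {s : Fin 3 → ℝ | ∃ i, s i < 0} := by
  rw [Set.setOf_exists]
  exact MeasurableSet.iUnion fun i => measurableSet_lt (measurable_pi_apply i) measurable_const

/-- `ν` lives on the closed octant. [folklore] -/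
theorem gsmMeasure_negSet : gsmMeasure {s | ∃ i, s i < 0} = 0 := by
  rw [gsmMeasure, Measure.finsetSum_apply]
  refine Finset.sum_eq_zero fun i _ => ?_
  rw [Measure.map_apply (measurable_rayVec i) measurableSet_negSet,
    Measure.restrict_apply' measurableSet_Ioi]
  have : rayVec i ⁻¹' {s : Fin 3 → ℝ | ∃ i, s i < 0} ∩ Ioi 0 = ∅ := by
    ext r
    simp only [Set.mem_inter_iff, Set.mem_preimage, Set.mem_setOf_eq, Set.mem_Ioi,
      Set.mem_empty_iff_false, iff_false, not_and, forall_exists_index]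
    intro j hj hr
    have : 0 < rayVec i r j := by
      unfold rayVec; split_ifs <;> nlinarith
    linarith
  rw [this, measure_empty]

/-- The Gaussian exponent along the ray: `Σⱼ (rayVec i r)ⱼ xⱼ² = (‖x‖² + xᵢ²) r`. [folklore] -/
theorem sum_rayVec_mul_sq (i : Fin 3) (x : E3) (r : ℝ) :
    ∑ j, rayVec i r j * (x j) ^ 2 = ((∑ j, x j ^ 2) + x i ^ 2) * r := by
  fin_cases i <;> simp [rayVec, Fin.sum_univ_three] <;> ring

/-- The Gaussian integrand of the crux is continuous in `s`. [folklore] -/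
theorem continuous_gaussIntegrand (x : E3) :
    Continuous fun s : Fin 3 → ℝ => Real.exp (-∑ i, s i * (x i) ^ 2) :=
  Real.continuous_exp.comp (continuous_finsetSum _ fun i _ =>
    (continuous_apply i).mul continuous_const).neg

/-- `∫₀^∞ e^{-l u} du = 1/l` for `l > 0`. [folklore] -/
theorem integral_exp_neg_mul_Ioi {l : ℝ} (hl : 0 < l) :
    ∫ u in Ioi (0 : ℝ), Real.exp (-(l * u)) = 1 / l := by
  have h := integral_exp_mul_Ioi (a := -l) (by linarith) 0
  simp only [mul_zero, Real.exp_zero, neg_mul] at h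
  rw [h, neg_div_neg_eq]

/-- **The witness is a Gaussian scale mixture in the sense of the crux**: `ν` lives on the closed
octant and `K x = ∫ exp(-Σ sᵢ xᵢ²) dν(s)` with an integrable integrand at every `x ≠ 0`. [folklore] -/
theorem threeAtomKernel_isGSM :
    ∃ ν : MeasureTheory.Measure (Fin 3 → ℝ), ν {s | ∃ i, s i < 0} = 0 ∧
      ∀ x : E3, x ≠ 0 → MeasureTheory.Integrable (fun s => Real.exp (-∑ i, s i * (x i) ^ 2)) ν ∧
        threeAtomKernel x = ∫ s, Real.exp (-∑ i, s i * (x i) ^ 2) ∂ν := by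
  refine ⟨gsmMeasure, gsmMeasure_negSet, fun x hx => ?_⟩
  set g : (Fin 3 → ℝ) → ℝ := fun s => Real.exp (-∑ i, s i * (x i) ^ 2) with hg
  have hgc : Continuous g := continuous_gaussIntegrand x
  have hcomp : ∀ i, g ∘ rayVec i = fun r => Real.exp (-((∑ j, x j ^ 2) + x i ^ 2) * r) := by
    intro i; funext r
    simp only [Function.comp_apply, hg, sum_rayVec_mul_sq, neg_mul]
  have hint : ∀ i, Integrable g (Measure.map (rayVec i) (volume.restrict (Ioi (0:ℝ)))) := by
    intro i
    rw [integrable_map_measure hgc.aestronglyMeasurable (measurable_rayVec i).aemeasurable, hcomp i]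
    exact exp_neg_integrableOn_Ioi 0 (denom_pos hx i)
  refine ⟨integrable_finsetSum_measure.2 fun i _ => hint i, ?_⟩
  rw [gsmMeasure, integral_finsetSum_measure fun i _ => hint i]
  unfold threeAtomKernel
  refine Finset.sum_congr rfl fun i _ => ?_
  rw [integral_map (measurable_rayVec i).aemeasurable hgc.aestronglyMeasurable]
  have := integral_exp_neg_mul_Ioi (denom_pos hx i)
  rw [← this]
  refine integral_congr_ae (Filter.Eventually.of_forall fun r => ?_)
  have h := congrFun (hcomp i) r
  simp only [Function.comp_apply] at h
  simp only [h, neg_mul]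

/-! ## Reflection positivity is load-bearing -/

/-- The crux with its RP conjunct deleted implies the crux (it has fewer hypotheses). [folklore] -/
theorem gsmRigidity_of_withoutRP
    (h : ∀ (Δ : ℝ) (K : E3 → ℝ), 1/2 ≤ Δ → Δ ≤ 1 → ContinuousOn K {0}ᶜ → (∀ x, x ≠ 0 → 0 < K x) →
      (∀ c : ℝ, 0 < c → ∀ x, K (c • x) = c ^ (-(2 * Δ)) * K x) →
      (∀ n : E3, (∃ i j : Fin 3, i ≠ j ∧ (n = EuclideanSpace.single i 1 ∨
        n = EuclideanSpace.single i 1 + EuclideanSpace.single j 1 ∨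
        n = EuclideanSpace.single i 1 - EuclideanSpace.single j 1)) →
        ∀ x, K (((ℝ ∙ n)ᗮ).reflection x) = K x) →
      (∃ ν : MeasureTheory.Measure (Fin 3 → ℝ), ν {s | ∃ i, s i < 0} = 0 ∧
        ∀ x, x ≠ 0 → MeasureTheory.Integrable (fun s => Real.exp (-∑ i, s i * (x i) ^ 2)) ν ∧
          K x = ∫ s, Real.exp (-∑ i, s i * (x i) ^ 2) ∂ν) →
      ∀ (R : E3 ≃ₗᵢ[ℝ] E3) (x : E3), K (R x) = K x) :
    Summit.CriticalPhenomena.Ising3DConformalLimit.Theses.GaussianScaleMixture.GSMRigidity := by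
  intro Δ K h1 h2 hc hpos hhom hnine hgsm R x
  exact h Δ K h1 h2 hc hpos hhom (fun n hn => (hnine n hn).1) hgsm R x

/-- **Reflection positivity is load-bearing for `GSMRigidity`**: the crux with its RP conjunct
deleted (all nine mirror invariances, window, continuity, positivity, homogeneity and the Gaussian
scale mixture representation kept) is FALSE — witness `threeAtomKernel` at `Δ = 1`, which is
anisotropic: `K e₀ = 5/2 ≠ 297/130 = K (θ_{(1,1,1)} e₀)`. [folklore] -/
theorem not_gsmRigidity_without_RP :
    ¬ ∀ (Δ : ℝ) (K : E3 → ℝ), 1/2 ≤ Δ → Δ ≤ 1 → ContinuousOn K {0}ᶜ → (∀ x, x ≠ 0 → 0 < K x) →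
      (∀ c : ℝ, 0 < c → ∀ x, K (c • x) = c ^ (-(2 * Δ)) * K x) →
      (∀ n : E3, (∃ i j : Fin 3, i ≠ j ∧ (n = EuclideanSpace.single i 1 ∨
        n = EuclideanSpace.single i 1 + EuclideanSpace.single j 1 ∨
        n = EuclideanSpace.single i 1 - EuclideanSpace.single j 1)) →
        ∀ x, K (((ℝ ∙ n)ᗮ).reflection x) = K x) →
      (∃ ν : MeasureTheory.Measure (Fin 3 → ℝ), ν {s | ∃ i, s i < 0} = 0 ∧
        ∀ x, x ≠ 0 → MeasureTheory.Integrable (fun s => Real.exp (-∑ i, s i * (x i) ^ 2)) ν ∧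
          K x = ∫ s, Real.exp (-∑ i, s i * (x i) ^ 2) ∂ν) →
      ∀ (R : E3 ≃ₗᵢ[ℝ] E3) (x : E3), K (R x) = K x := by
  intro h
  have key := h 1 threeAtomKernel (by norm_num) le_rfl threeAtomKernel_continuousOn
    (fun x hx => threeAtomKernel_pos hx) (fun c hc x => threeAtomKernel_smul hc x)
    (fun n hn x => threeAtomKernel_reflection n hn x) threeAtomKernel_isGSM
    ((ℝ ∙ v111)ᗮ.reflection) (EuclideanSpace.single 0 1)
  rw [threeAtomKernel_reflection_v111_e0, threeAtomKernel_e0] at key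
  norm_num at key

/-! ## Which reflection positivity kills the witness: the swap mirror `x₁ = x₂` -/

/-- Points in the plane `x₃ = 0`. [folklore] -/
def mk (a b : ℝ) : E3 := EuclideanSpace.single 0 a + EuclideanSpace.single 1 b

/-- First coordinate of `mk a b`. [folklore] -/
@[simp] theorem mk_apply_zero (a b : ℝ) : mk a b 0 = a := by simp [mk]
/-- Second coordinate of `mk a b`. [folklore] -/
@[simp] theorem mk_apply_one (a b : ℝ) : mk a b 1 = b := by simp [mk]
/-- Third coordinate of `mk a b`. [folklore] -/
@[simp] theorem mk_apply_two (a b : ℝ) : mk a b 2 = 0 := by simp [mk]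

/-- The swap normal `e₀ - e₁` (one of the six diagonal lattice mirror normals). [folklore] -/
def nSwap : E3 := EuclideanSpace.single 0 1 - EuclideanSpace.single 1 1

/-- `⟪mk a b, e₀ - e₁⟫ = a - b`. [folklore] -/
theorem inner_mk_nSwap (a b : ℝ) : inner ℝ (mk a b) nSwap = a - b := by
  rw [real_inner_comm, nSwap, inner_single_sub_single_left, mk_apply_zero, mk_apply_one]

/-- The swap mirror swaps the first two coordinates. [folklore] -/
theorem reflection_nSwap_mk (a b : ℝ) : (ℝ ∙ nSwap)ᗮ.reflection (mk a b) = mk b a := by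
  ext l
  rw [nSwap, reflection_single_sub_single_apply (by decide : (0 : Fin 3) ≠ 1)]
  fin_cases l <;> simp [Equiv.swap_apply_left, Equiv.swap_apply_right,
    Equiv.swap_apply_of_ne_of_ne]

/-- Differences of planar points. [folklore] -/
theorem mk_sub_mk (a b c d : ℝ) : mk a b - mk c d = mk (a - c) (b - d) := by
  ext l
  fin_cases l <;> simp

/-- The witness on the plane `x₃ = 0`. [folklore] -/
theorem threeAtomKernel_mk (u v : ℝ) :
    threeAtomKernel (mk u v) = 1 / (2 * u ^ 2 + v ^ 2) + 1 / (u ^ 2 + 2 * v ^ 2) + 1 / (u ^ 2 + v ^ 2) := by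
  unfold threeAtomKernel
  simp only [Fin.sum_univ_three, mk_apply_zero, mk_apply_one, mk_apply_two]
  ring_nf

/-- **The three-atom Gaussian scale mixture is NOT reflection positive for the swap mirror
`x₁ = x₂`.** Points `(3,-3,0), (4,-2,0), (5,-1,0), (6,0,0)` (all with `x₁ - x₂ = 6 > 0`),
coefficients `(5,-14,14,-5)`: the RP quadratic form `Σ c_a c_b K(p_a - θ p_b)` equals
`-3305/17120862 < 0` (the differences are `(6+d, d-6, 0)`, `d = a - b`, and
`K(6+d, d-6, 0) = 7/216, 9535/300366, 43/1440, 509/18810` for `|d| = 0, 1, 2, 3`). An alternating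
third difference ALONG the mirror at fixed height: the finite shadow of the Stieltjes-pencil
obstruction (transverse momentum along `e₀ + e₁`, large mirror time). [folklore] -/
theorem threeAtomKernel_not_swapRP : ¬ IsMirrorRPKernel nSwap threeAtomKernel := by
  intro h
  have key := h 4 ![mk 3 (-3), mk 4 (-2), mk 5 (-1), mk 6 0] ![5, -14, 14, -5] (by
    intro a
    fin_cases a <;> simp [inner_mk_nSwap] <;> norm_num)
  simp only [Fin.sum_univ_four, Matrix.cons_val_zero, Matrix.cons_val_one, Matrix.cons_val,
    reflection_nSwap_mk, mk_sub_mk, threeAtomKernel_mk] at key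
  norm_num at key

end Summit.CriticalPhenomena.Ising3DConformalLimit.Theorems.GSMRigidity.Negative
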